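import Literature.Computability.Complexity.UmansFPField
import Literature.Computability.Complexity.CodeFPLists
import HarnessLib

/-!
# Umans' generator, machine level II: the extension ring `K[z]/(p)` on lists of bitmasks

Literature / circuit complexity — derandomization. Second machine-level file of the tree's proof of
C. Umans, JCSS 2003, Thm. 6. Over the base field `K = GF2 M` of `UmansFPField.lean` (bitmask
codes), the elements of `L = K[z]/(p)` for a monic `p = z^d + Σ_{j<d} p_j z^j` (given by the list
`pc = [p₀, …, p_{d-1}]` of coefficient bitmasks) travel as coefficient lists `[u₀, …, u_{d-1}]`
(Umans, §3: "elements of `F_{q^d}` are represented as vectors in `F_q^d` … we think of `F_{q^d}` as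
polynomials in `z` modulo an irreducible degree `d` polynomial `p(z)`"). This file gives the
arithmetic as total functional programs on `List ℕ`, proves what they compute in the ring
`AdjoinRoot (pOf M pc)` through `lElt` (`ladd_spec`, `lsmul_spec`, `lmulz_spec`, `lmul_spec`,
`lpowU_spec`, `lsqIter_spec` — sums, scalar multiples, multiplication by `z`, products by Horner's
rule, powers by unary exponent, iterated squaring `u ↦ u^{2^k}`, powers by binary exponent
`lpowB_spec`), the representation invariant `LRep` (length `d`, reduced entries) they preserve, the
size invariants they satisfy on ARBITRARY inputs (entries below `2ᵂ`, lengths at most `|pc|`: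
`foldl_lmulStep_bound`, …), and their `CodeFP` certificates (`laddFP`, `lsmulFP`, `lmulzFP`,
`lmulFP`, `loneFP`, `lpowUFP`, `lsqIterFP`, `lpowBFP`) — the loops by `CodeFP.foldl`, whose one
hypothesis (a polynomial bound on the accumulator's code) is the size invariant.

Everything is proved; no named fact.

## References

* C. Umans, *Pseudo-random generators for all hardnesses*, JCSS 67 (2003), §3 [Umans2003].
* D. E. Knuth, *The Art of Computer Programming*, Vol. 2, §4.6.1–4.6.3 (polynomial arithmetic,
  Horner, powers) [KnuthTAOCP2].
* S. Arora, B. Barak, *Computational Complexity: A Modern Approach*, CUP 2009, §1.3 [AroraBarak2009].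
-/

noncomputable section

namespace Literature.Computability.Complexity

open Polynomial Literature.InformationTheory.Coding
open Literature.InformationTheory.Coding.GF2X CodeFP

namespace UmansFP

variable (M : ℕ)

/-! ### Coefficient lists as polynomials over `K`, and the ring `K[z]/(p)` -/

/-- The polynomial over `GF2 M` with coefficient bitmask list `u`: `Σ_{j<|u|} elt(u_j) Xʲ`.
[cite: Umans2003, §3] -/
def polyOfList (u : List ℕ) : (GF2 M)[X] :=
  ∑ j ∈ Finset.range u.length, C (GF2.elt M (u.getD j 0)) * X ^ j

/-- Coefficients of `polyOfList`. [folklore] -/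
theorem coeff_polyOfList (u : List ℕ) (j : ℕ) :
    (polyOfList M u).coeff j = if j < u.length then GF2.elt M (u.getD j 0) else 0 := by
  rw [polyOfList, finsetSum_coeff]
  simp_rw [coeff_C_mul_X_pow]
  rw [Finset.sum_ite_eq (Finset.range u.length) j]
  simp [Finset.mem_range]

/-- `polyOfList` has degree `< |u|`. [folklore] -/
theorem degree_polyOfList_lt (u : List ℕ) : (polyOfList M u).degree < u.length := by
  rw [polyOfList]
  refine (degree_sum_le _ _).trans_lt ((Finset.sup_lt_iff (WithBot.bot_lt_coe _)).2 fun j hj => ?_)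
  exact (degree_C_mul_X_pow_le _ _).trans_lt (WithBot.coe_lt_coe.2 (Finset.mem_range.1 hj))

/-- **The monic modulus** `p = z^d + Σ_{j<d} p_j zʲ` of the coefficient list `pc` (`d = |pc|`).
[cite: Umans2003, §3] -/
def pOf (pc : List ℕ) : (GF2 M)[X] := X ^ pc.length + polyOfList M pc

/-- `pOf` is monic. [folklore] -/
theorem monic_pOf (pc : List ℕ) : (pOf M pc).Monic := by
  rw [pOf]; exact monic_X_pow_add (degree_polyOfList_lt M pc)

/-- `deg pOf = d`. [folklore] -/
theorem natDegree_pOf [Nontrivial (GF2 M)] (pc : List ℕ) : (pOf M pc).natDegree = pc.length := by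
  rw [pOf, natDegree_add_eq_left_of_degree_lt, natDegree_X_pow]
  rw [degree_X_pow]; exact degree_polyOfList_lt M pc

/-- **The element of `K[z]/(p)` with coefficient list `u`**. [cite: Umans2003, §3] -/
def lElt (pc u : List ℕ) : AdjoinRoot (pOf M pc) := AdjoinRoot.mk (pOf M pc) (polyOfList M u)

/-- **The representation invariant**: length `d` and reduced entries. [folklore] -/
def LRep (d : ℕ) (u : List ℕ) : Prop := u.length = d ∧ ∀ x ∈ u, x < 2 ^ (M + 1)

variable {M}

/-- Membership in an `LRep` list gives a reduced bitmask. [folklore] -/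
theorem LRep.getD_lt {d : ℕ} {u : List ℕ} (h : LRep M d u) (j : ℕ) : u.getD j 0 < 2 ^ (M + 1) := by
  by_cases hj : j < u.length
  · rw [List.getD_eq_getElem _ _ hj]; exact h.2 _ (List.getElem_mem hj)
  · rw [List.getD_eq_default _ _ (not_lt.1 hj)]; exact Nat.two_pow_pos _

variable (M)

/-- Appending a coefficient. [folklore] -/
theorem polyOfList_append_singleton (u : List ℕ) (a : ℕ) :
    polyOfList M (u ++ [a]) = polyOfList M u + C (GF2.elt M a) * X ^ u.length := by
  ext j
  rw [coeff_add, coeff_polyOfList, coeff_polyOfList, coeff_C_mul_X_pow]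
  simp only [List.length_append, List.length_singleton]
  by_cases h1 : j < u.length
  · rw [if_pos (by omega), if_pos h1, if_neg (by omega), add_zero, List.getD_append _ _ _ _ h1]
  · by_cases h2 : j = u.length
    · subst h2
      rw [if_pos (by omega), if_neg h1, if_pos rfl, zero_add, List.getD_append_right _ _ _ _ le_rfl]
      simp
    · rw [if_neg (by omega), if_neg h1, if_neg h2, add_zero]

/-- `polyOfList []` is `0`. [folklore] -/
@[simp] theorem polyOfList_nil : polyOfList M [] = 0 := by simp [polyOfList]

/-- `polyOfList` of an all-zero list is `0`. [folklore] -/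
theorem polyOfList_replicate_zero (d : ℕ) : polyOfList M (List.replicate d 0) = 0 := by
  ext j
  rw [coeff_polyOfList, coeff_zero]
  split_ifs with h
  · rw [List.length_replicate] at h
    rw [List.getD_eq_getElem _ _ (by simpa using h), List.getElem_replicate, GF2.elt, bitsPoly_zero, map_zero]
  · rfl

/-! ### The programs -/

/-- The product brick of `K` in the context `c = (W, f, P)`. [cite: KnuthTAOCP2, §4.6.3] -/
def cmul (c : ℕ × ℕ × ℕ) (a b : ℕ) : ℕ := GF2X.mulMod c.1 c.2.1 c.2.2 c.1 a b

/-- The inverse brick of `K` in the context `c` (Fermat, binary powering). [cite: KnuthTAOCP2, §4.6.3] -/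
def cinv (c : ℕ × ℕ × ℕ) (a : ℕ) : ℕ := kpowB c a (c.2.2 - 2) c.1

/-- In the context of `GF2 M`, `cmul` is `kmul`. [folklore] -/
theorem cmul_kctx (M a b : ℕ) : cmul (kctx M) a b = kmul M a b := rfl

/-- In the context of `GF2 M`, `cinv` is `kinv`. [folklore] -/
theorem cinv_kctx (M a : ℕ) : cinv (kctx M) a = kinv M a := rfl


/-- **Sum**: entrywise `xor` at width `W`. [cite: KnuthTAOCP2, §4.6.1] -/
def ladd (W : ℕ) (u v : List ℕ) : List ℕ := List.zipWith (xorW W) u v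

/-- **Scalar multiple** by the `K`-element `a` (brick `mulMod` in the context `c = (W, f, P)`).
[cite: KnuthTAOCP2, §4.6.1] -/
def lsmul (c : ℕ × ℕ × ℕ) (a : ℕ) (u : List ℕ) : List ℕ :=
  u.map fun x => GF2X.mulMod c.1 c.2.1 c.2.2 c.1 a x

/-- **Multiplication by `z` modulo `p`**: shift up and add `u_{d-1} • (p₀, …, p_{d-1})`
(`z^d = Σ p_j zʲ` in characteristic `2`). [cite: KnuthTAOCP2, §4.6.1] -/
def lmulz (c : ℕ × ℕ × ℕ) (pc u : List ℕ) : List ℕ :=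
  List.zipWith (xorW c.1) (0 :: u) (lsmul c (u.getD (pc.length - 1) 0) pc)

/-- One Horner round of the product: `(acc, w) ↦ (acc + a • w, z · w)`. [cite: KnuthTAOCP2, §4.6.1] -/
def lmulStep (c : ℕ × ℕ × ℕ) (pc : List ℕ) (st : List ℕ × List ℕ) (a : ℕ) : List ℕ × List ℕ :=
  (ladd c.1 st.1 (lsmul c a st.2), lmulz c pc st.2)

/-- **Product** `u · v` in `K[z]/(p)`: `Σ_j v_j (zʲ u)`, the powers `zʲ u` updated alongside.
[cite: KnuthTAOCP2, §4.6.1] -/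
def lmul (c : ℕ × ℕ × ℕ) (pc u v : List ℕ) : List ℕ :=
  (v.foldl (lmulStep c pc) (List.replicate pc.length 0, u)).1

/-- **The unit** `[1, 0, …, 0]` of length `d` (`[]` for `d = 0`). [folklore] -/
def lone (d : ℕ) : List ℕ := (List.range d).map fun j => if j = 0 then 1 else 0

/-- **Power with unary exponent**: `e` products. [cite: KnuthTAOCP2, §4.6.3] -/
def lpowU (c : ℕ × ℕ × ℕ) (pc u : List ℕ) (e : ℕ) : List ℕ :=
  (List.replicate e ()).foldl (fun acc _ => lmul c pc acc u) (lone pc.length)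

/-- **Iterated squaring**: `u ↦ u^{2^k}` by `k` squarings. [cite: KnuthTAOCP2, §4.6.3] -/
def lsqIter (c : ℕ × ℕ × ℕ) (pc u : List ℕ) (k : ℕ) : List ℕ :=
  (List.replicate k ()).foldl (fun w _ => lmul c pc w w) u

/-- One round of right-to-left binary powering on the state `(acc, p, z')`:
`acc ← acc · p` if `z'` is odd, `p ← p²`, `z' ← ⌊z'/2⌋`. [cite: KnuthTAOCP2, §4.6.3, Algorithm A] -/
def lpowBStep (c : ℕ × ℕ × ℕ) (pc : List ℕ) (st : List ℕ × List ℕ × ℕ) : List ℕ × List ℕ × ℕ :=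
  (if st.2.2 % 2 = 1 then lmul c pc st.1 st.2.1 else st.1, lmul c pc st.2.1 st.2.1, st.2.2 / 2)

/-- **Power with binary exponent** `z` and a unary round budget `B` (correct when `z < 2^B`):
right-to-left binary method. [cite: KnuthTAOCP2, §4.6.3, Algorithm A] -/
def lpowB (c : ℕ × ℕ × ℕ) (pc u : List ℕ) (z B : ℕ) : List ℕ :=
  ((List.replicate B ()).foldl (fun st _ => lpowBStep c pc st) (lone pc.length, u, z)).1

/-! ### What the programs compute -/

section Spec

variable {d : ℕ} {pc : List ℕ}

/-- **`ladd` computes the sum** and keeps the invariant. [cite: KnuthTAOCP2, §4.6.1] -/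
theorem ladd_spec {u v : List ℕ} (hu : LRep M d u) (hv : LRep M d v) :
    LRep M d (ladd (M + 2) u v) ∧ polyOfList M (ladd (M + 2) u v) = polyOfList M u + polyOfList M v := by
  have hlen : (ladd (M + 2) u v).length = d := by rw [ladd, List.length_zipWith, hu.1, hv.1, min_self]
  have hent : ∀ j, j < d → (ladd (M + 2) u v).getD j 0 = xorW (M + 2) (u.getD j 0) (v.getD j 0) := by
    intro j hj
    rw [ladd, List.getD_eq_getElem _ _ (by rw [List.length_zipWith, hu.1, hv.1, min_self]; exact hj),
      List.getElem_zipWith, List.getD_eq_getElem _ _ (by rw [hu.1]; exact hj),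
      List.getD_eq_getElem _ _ (by rw [hv.1]; exact hj)]
  refine ⟨⟨hlen, fun x hx => ?_⟩, ?_⟩
  · obtain ⟨j, hj, rfl⟩ := List.getElem_of_mem hx
    rw [hlen] at hj
    rw [← List.getD_eq_getElem _ 0 (by rw [hlen]; exact hj), hent j hj]
    exact (elt_xorW M (by omega) (hu.getD_lt j) (hv.getD_lt j)).2
  · ext j
    rw [coeff_add, coeff_polyOfList, coeff_polyOfList, coeff_polyOfList, hlen, hu.1, hv.1]
    split_ifs with hj
    · rw [hent j hj]; exact (elt_xorW M (by omega) (hu.getD_lt j) (hv.getD_lt j)).1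
    · rw [add_zero]

/-- **`lsmul` computes the scalar multiple** and keeps the invariant. [cite: KnuthTAOCP2, §4.6.1] -/
theorem lsmul_spec {a : ℕ} (ha : a < 2 ^ (M + 1)) {u : List ℕ} (hu : LRep M d u) :
    LRep M d (lsmul (kctx M) a u) ∧ polyOfList M (lsmul (kctx M) a u) = C (GF2.elt M a) * polyOfList M u := by
  have hlen : (lsmul (kctx M) a u).length = d := by rw [lsmul, List.length_map, hu.1]
  have hent : ∀ j, j < d → (lsmul (kctx M) a u).getD j 0 = kmul M a (u.getD j 0) := by
    intro j hj
    rw [lsmul, List.getD_eq_getElem _ _ (by rw [List.length_map, hu.1]; exact hj), List.getElem_map,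
      List.getD_eq_getElem _ _ (by rw [hu.1]; exact hj)]
    rfl
  refine ⟨⟨hlen, fun x hx => ?_⟩, ?_⟩
  · obtain ⟨j, hj, rfl⟩ := List.getElem_of_mem hx
    rw [hlen] at hj
    rw [← List.getD_eq_getElem _ 0 (by rw [hlen]; exact hj), hent j hj]
    exact (kmul_spec M ha (hu.getD_lt j)).2
  · ext j
    rw [coeff_C_mul, coeff_polyOfList, coeff_polyOfList, hlen, hu.1]
    split_ifs with hj
    · rw [hent j hj]; exact (kmul_spec M ha (hu.getD_lt j)).1
    · rw [mul_zero]

/-- **`lmulz` computes multiplication by `z` modulo `p`**: in `K[X]`,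
`X · polyOfList u = polyOfList (lmulz u) + C(u_{d-1}) · pOf pc` (characteristic `2`), and the
invariant is kept (`d = |pc| ≥ 1`). [cite: KnuthTAOCP2, §4.6.1] -/
theorem lmulz_spec (hpc : LRep M d pc) (hd : 1 ≤ d) {u : List ℕ} (hu : LRep M d u) :
    LRep M d (lmulz (kctx M) pc u) ∧
      X * polyOfList M u = polyOfList M (lmulz (kctx M) pc u) + C (GF2.elt M (u.getD (d - 1) 0)) * pOf M pc := by
  have hpcl : pc.length = d := hpc.1
  set lead := u.getD (d - 1) 0 with hlead
  have hleadlt : lead < 2 ^ (M + 1) := hu.getD_lt _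
  obtain ⟨hsm, hsmpoly⟩ := lsmul_spec M hleadlt hpc
  have hlen : (lmulz (kctx M) pc u).length = d := by
    rw [lmulz, List.length_zipWith, List.length_cons, hpcl, hu.1, hsm.1]; omega
  -- entries of the result
  have hent : ∀ j, j < d → (lmulz (kctx M) pc u).getD j 0 =
      xorW (M + 2) ((0 :: u).getD j 0) ((lsmul (kctx M) lead pc).getD j 0) := by
    intro j hj
    rw [lmulz, hpcl, ← hlead, List.getD_eq_getElem _ _ (by rw [List.length_zipWith, List.length_cons, hu.1, hsm.1]; omega),
      List.getElem_zipWith, List.getD_eq_getElem _ _ (by rw [List.length_cons, hu.1]; omega),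
      List.getD_eq_getElem _ _ (by rw [hsm.1]; exact hj)]
    rfl
  have h0u : ∀ j, (0 :: u).getD j 0 < 2 ^ (M + 1) := by
    intro j; cases j with
    | zero => simp
    | succ j => rw [List.getD_cons_succ]; exact hu.getD_lt j
  refine ⟨⟨hlen, fun x hx => ?_⟩, ?_⟩
  · obtain ⟨j, hj, rfl⟩ := List.getElem_of_mem hx
    rw [hlen] at hj
    rw [← List.getD_eq_getElem _ 0 (by rw [hlen]; exact hj), hent j hj]
    exact (elt_xorW M (by omega) (h0u j) (hsm.getD_lt j)).2
  · -- coefficient comparison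
    haveI : CharP (GF2 M) 2 := GF2.charP M
    have hsmcoeff : ∀ j, j < d → GF2.elt M ((lsmul (kctx M) lead pc).getD j 0) = GF2.elt M lead * GF2.elt M (pc.getD j 0) := by
      intro j hj
      have := congrArg (fun q : (GF2 M)[X] => q.coeff j) hsmpoly
      simp only [coeff_C_mul, coeff_polyOfList, hsm.1, hpcl, if_pos hj] at this
      exact this
    ext j
    have hXu : (X * polyOfList M u).coeff j = if 1 ≤ j ∧ j ≤ d then GF2.elt M (u.getD (j - 1) 0) else 0 := by
      cases j with
      | zero => rw [mul_comm, coeff_mul_X_zero]; simp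
      | succ j =>
        rw [mul_comm, coeff_mul_X, coeff_polyOfList, hu.1]
        by_cases h : j < d
        · rw [if_pos h, if_pos (by omega)]; rfl
        · rw [if_neg h, if_neg (by omega)]
    have hR : (polyOfList M (lmulz (kctx M) pc u)).coeff j =
        if j < d then GF2.elt M ((0 :: u).getD j 0) + GF2.elt M lead * GF2.elt M (pc.getD j 0) else 0 := by
      rw [coeff_polyOfList, hlen]
      split_ifs with hj
      · rw [hent j hj, (elt_xorW M (by omega) (h0u j) (hsm.getD_lt j)).1, hsmcoeff j hj]
      · rfl
    have hP : (C (GF2.elt M lead) * pOf M pc).coeff j =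
        GF2.elt M lead * ((if j = d then 1 else 0) + if j < d then GF2.elt M (pc.getD j 0) else 0) := by
      rw [coeff_C_mul, pOf, coeff_add, coeff_X_pow, coeff_polyOfList, hpcl]
    rw [coeff_add, hXu, hR, hP]
    by_cases hj : j < d
    · have hjd : ¬ j = d := by omega
      simp only [if_pos hj, if_neg hjd, zero_add]
      cases j with
      | zero =>
        have h10 : ¬ (1 ≤ 0 ∧ 0 ≤ d) := by omega
        rw [if_neg h10, List.getD_cons_zero, GF2.elt, bitsPoly_zero, map_zero, zero_add,
          CharTwo.add_self_eq_zero]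
      | succ j =>
        have h11 : 1 ≤ j + 1 ∧ j + 1 ≤ d := by omega
        rw [if_pos h11, List.getD_cons_succ, Nat.add_sub_cancel, add_assoc, CharTwo.add_self_eq_zero, add_zero]
    · simp only [if_neg hj, add_zero, zero_add]
      by_cases hjd : j = d
      · subst hjd
        rw [if_pos ⟨hd, le_rfl⟩, if_pos rfl, mul_one]
      · have h12 : ¬ (1 ≤ j ∧ j ≤ d) := by omega
        rw [if_neg h12, if_neg hjd, mul_zero]

/-- In the quotient, `lmulz` is multiplication by the root `z`. [cite: KnuthTAOCP2, §4.6.1] -/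
theorem lElt_lmulz (hpc : LRep M d pc) (hd : 1 ≤ d) {u : List ℕ} (hu : LRep M d u) :
    lElt M pc (lmulz (kctx M) pc u) = AdjoinRoot.root (pOf M pc) * lElt M pc u := by
  obtain ⟨-, hpoly⟩ := lmulz_spec M hpc hd hu
  rw [lElt, lElt, ← AdjoinRoot.mk_X, ← map_mul, hpoly, map_add, map_mul, AdjoinRoot.mk_self, mul_zero,
    add_zero]

/-- **The Horner invariant of `lmul`**: after the items `l`, the state is
`((Σ_{i<|l|} l_i zⁱ) · u, z^{|l|} · u)` in the quotient, with the invariant kept.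
[cite: KnuthTAOCP2, §4.6.1] -/
theorem foldl_lmulStep_spec (hpc : LRep M d pc) (hd : 1 ≤ d) {u : List ℕ} (hu : LRep M d u) :
    ∀ (l : List ℕ), (∀ a ∈ l, a < 2 ^ (M + 1)) → ∀ (acc w : List ℕ) (l₀ : List ℕ), LRep M d acc → LRep M d w →
      lElt M pc acc = lElt M pc l₀ * lElt M pc u →
      lElt M pc w = AdjoinRoot.root (pOf M pc) ^ l₀.length * lElt M pc u →
      LRep M d (l.foldl (lmulStep (kctx M) pc) (acc, w)).1 ∧ LRep M d (l.foldl (lmulStep (kctx M) pc) (acc, w)).2 ∧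
        lElt M pc (l.foldl (lmulStep (kctx M) pc) (acc, w)).1 = lElt M pc (l₀ ++ l) * lElt M pc u ∧
        lElt M pc (l.foldl (lmulStep (kctx M) pc) (acc, w)).2 =
          AdjoinRoot.root (pOf M pc) ^ (l₀.length + l.length) * lElt M pc u
  | [], _, acc, w, l₀, hacc, hw, h1, h2 => by simpa using ⟨hacc, hw, h1, h2⟩
  | a :: l, hl, acc, w, l₀, hacc, hw, h1, h2 => by
    have ha : a < 2 ^ (M + 1) := hl a (by simp)
    rw [List.foldl_cons]
    obtain ⟨hsm, hsmpoly⟩ := lsmul_spec M ha hw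
    obtain ⟨hadd, haddpoly⟩ := ladd_spec M hacc hsm
    obtain ⟨hz, -⟩ := lmulz_spec M hpc hd hw
    have h1' : lElt M pc (ladd (M + 2) acc (lsmul (kctx M) a w)) = lElt M pc (l₀ ++ [a]) * lElt M pc u := by
      have e1 : lElt M pc (ladd (M + 2) acc (lsmul (kctx M) a w)) =
          lElt M pc acc + AdjoinRoot.of (pOf M pc) (GF2.elt M a) * lElt M pc w := by
        simp only [lElt]
        rw [haddpoly, hsmpoly, map_add, map_mul, AdjoinRoot.mk_C]
      have e2 : lElt M pc (l₀ ++ [a]) =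
          lElt M pc l₀ + AdjoinRoot.of (pOf M pc) (GF2.elt M a) * AdjoinRoot.root (pOf M pc) ^ l₀.length := by
        simp only [lElt]
        rw [polyOfList_append_singleton, map_add, map_mul, AdjoinRoot.mk_C, map_pow, AdjoinRoot.mk_X]
      rw [e1, e2, h1, h2]; ring
    have h2' : lElt M pc (lmulz (kctx M) pc w) = AdjoinRoot.root (pOf M pc) ^ (l₀ ++ [a]).length * lElt M pc u := by
      rw [lElt_lmulz M hpc hd hw, h2, List.length_append, List.length_singleton, pow_succ]; ring
    have := foldl_lmulStep_spec hpc hd hu l (fun b hb => hl b (List.mem_cons_of_mem _ hb)) _ _ (l₀ ++ [a])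
      hadd hz h1' h2'
    simp only [lmulStep, kctx] at this ⊢
    rw [List.append_assoc, List.singleton_append, List.length_append, List.length_singleton] at this
    refine ⟨this.1, this.2.1, this.2.2.1, ?_⟩
    rw [this.2.2.2, List.length_cons]; congr 2; omega

/-- **`lmul` computes the product** in `K[z]/(p)` and keeps the invariant.
[cite: KnuthTAOCP2, §4.6.1] -/
theorem lmul_spec (hpc : LRep M d pc) (hd : 1 ≤ d) {u v : List ℕ} (hu : LRep M d u) (hv : LRep M d v) :
    LRep M d (lmul (kctx M) pc u v) ∧ lElt M pc (lmul (kctx M) pc u v) = lElt M pc u * lElt M pc v := by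
  have hzero : LRep M d (List.replicate pc.length 0) := ⟨by rw [List.length_replicate, hpc.1], fun x hx => by
    rw [List.eq_of_mem_replicate hx]; exact Nat.two_pow_pos _⟩
  have h := foldl_lmulStep_spec M hpc hd hu v hv.2 _ u [] hzero hu
    (by rw [lElt, lElt, polyOfList_nil, map_zero, hpc.1, polyOfList_replicate_zero, map_zero, zero_mul])
    (by simp)
  simp only [List.nil_append, List.length_nil, zero_add] at h
  exact ⟨h.1, by rw [lmul, h.2.2.1, mul_comm]⟩

/-- The unit list represents `1` (for `d ≥ 1`). [folklore] -/
theorem lone_spec (_hpc : LRep M d pc) (hd : 1 ≤ d) : LRep M d (lone d) ∧ lElt M pc (lone d) = 1 := by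
  have hlen : (lone d).length = d := by rw [lone, List.length_map, List.length_range]
  have hent : ∀ j, j < d → (lone d).getD j 0 = if j = 0 then 1 else 0 := by
    intro j hj
    rw [lone, List.getD_eq_getElem _ _ (by rw [List.length_map, List.length_range]; exact hj), List.getElem_map,
      List.getElem_range]
  refine ⟨⟨hlen, fun x hx => ?_⟩, ?_⟩
  · obtain ⟨j, hj, rfl⟩ := List.getElem_of_mem hx
    rw [hlen] at hj
    rw [← List.getD_eq_getElem _ 0 (by rw [hlen]; exact hj), hent j hj]
    split_ifs
    · exact Nat.one_lt_two_pow (by omega)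
    · exact Nat.two_pow_pos _
  · rw [lElt, ← map_one (AdjoinRoot.mk (pOf M pc))]
    congr 1
    ext j
    rw [coeff_polyOfList, hlen, coeff_one]
    by_cases hj : j < d
    · rw [if_pos hj, hent j hj]
      by_cases h0 : j = 0
      · subst h0; rw [if_pos rfl, if_pos rfl, GF2.elt, bitsPoly_one, map_one]
      · rw [if_neg h0, if_neg h0, GF2.elt, bitsPoly_zero, map_zero]
    · rw [if_neg hj, if_neg (by omega)]

/-- **`lpowU` computes the `e`-th power.** [cite: KnuthTAOCP2, §4.6.3] -/
theorem lpowU_spec (hpc : LRep M d pc) (hd : 1 ≤ d) {u : List ℕ} (hu : LRep M d u) (e : ℕ) :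
    LRep M d (lpowU (kctx M) pc u e) ∧ lElt M pc (lpowU (kctx M) pc u e) = lElt M pc u ^ e := by
  unfold lpowU
  rw [hpc.1]
  induction e with
  | zero => simpa using lone_spec M hpc hd
  | succ e ih =>
    rw [List.replicate_succ', List.foldl_append, List.foldl_cons, List.foldl_nil]
    obtain ⟨hrep, hval⟩ := ih
    obtain ⟨hrep', hval'⟩ := lmul_spec M hpc hd hrep hu
    exact ⟨hrep', by rw [hval', hval, pow_succ]⟩

/-- **`lsqIter` computes `u^{2^k}`.** [cite: KnuthTAOCP2, §4.6.3] -/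
theorem lsqIter_spec (hpc : LRep M d pc) (hd : 1 ≤ d) {u : List ℕ} (hu : LRep M d u) (k : ℕ) :
    LRep M d (lsqIter (kctx M) pc u k) ∧ lElt M pc (lsqIter (kctx M) pc u k) = lElt M pc u ^ (2 ^ k) := by
  unfold lsqIter
  induction k with
  | zero => simpa using hu
  | succ k ih =>
    rw [List.replicate_succ', List.foldl_append, List.foldl_cons, List.foldl_nil]
    obtain ⟨hrep, hval⟩ := ih
    obtain ⟨hrep', hval'⟩ := lmul_spec M hpc hd hrep hrep
    exact ⟨hrep', by rw [hval', hval, ← pow_add, ← two_mul, ← pow_succ']⟩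

/-- The loop invariant of `lpowB`: after `j` rounds the state is `(u^{z mod 2ʲ}, u^{2ʲ}, ⌊z/2ʲ⌋)`.
[cite: KnuthTAOCP2, §4.6.3] -/
theorem foldl_lpowBStep_spec (hpc : LRep M d pc) (hd : 1 ≤ d) {u : List ℕ} (hu : LRep M d u) (z : ℕ) (j : ℕ) :
    let st := (List.replicate j ()).foldl (fun st _ => lpowBStep (kctx M) pc st) (lone pc.length, u, z)
    LRep M d st.1 ∧ LRep M d st.2.1 ∧ lElt M pc st.1 = lElt M pc u ^ (z % 2 ^ j) ∧
      lElt M pc st.2.1 = lElt M pc u ^ (2 ^ j) ∧ st.2.2 = z / 2 ^ j := by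
  induction j with
  | zero =>
    obtain ⟨h1, h2⟩ := lone_spec M hpc hd
    rw [hpc.1]
    simpa [Nat.mod_one] using ⟨h1, hu, h2⟩
  | succ j ih =>
    obtain ⟨h1, h2, h3, h4, h5⟩ := ih
    simp only [List.replicate_succ', List.foldl_append, List.foldl_cons, List.foldl_nil]
    set st := (List.replicate j ()).foldl (fun st _ => lpowBStep (kctx M) pc st) (lone pc.length, u, z)
    obtain ⟨hsq, hsqv⟩ := lmul_spec M hpc hd h2 h2
    have hz : z % 2 ^ (j + 1) = z % 2 ^ j + 2 ^ j * (z / 2 ^ j % 2) := by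
      rw [pow_succ, Nat.mod_mul]
    refine ⟨?_, hsq, ?_, by rw [lpowBStep, hsqv, h4, ← pow_add, ← two_mul, ← pow_succ'], by
      rw [lpowBStep, h5, Nat.div_div_eq_div_mul, ← pow_succ]⟩
    · simp only [lpowBStep]
      split_ifs
      · exact (lmul_spec M hpc hd h1 h2).1
      · exact h1
    · simp only [lpowBStep]
      rw [hz, pow_add, ← h3, h5]
      split_ifs with hodd
      · rw [(lmul_spec M hpc hd h1 h2).2, h4, hodd, mul_one]
      · have h0 : z / 2 ^ j % 2 = 0 := by omega
        rw [h0, mul_zero, pow_zero, mul_one]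

/-- **`lpowB` computes `u ^ z`** when `z < 2^B`, and keeps the invariant. [cite: KnuthTAOCP2, §4.6.3] -/
theorem lpowB_spec (hpc : LRep M d pc) (hd : 1 ≤ d) {u : List ℕ} (hu : LRep M d u) {z B : ℕ} (hz : z < 2 ^ B) :
    LRep M d (lpowB (kctx M) pc u z B) ∧ lElt M pc (lpowB (kctx M) pc u z B) = lElt M pc u ^ z := by
  obtain ⟨h1, -, h3, -, -⟩ := foldl_lpowBStep_spec M hpc hd hu z B
  exact ⟨h1, by rw [lpowB, h3, Nat.mod_eq_of_lt hz]⟩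

end Spec

/-! ### Size invariants on arbitrary inputs (for the loop bounds) -/

section Bounds

variable (c : ℕ × ℕ × ℕ) (pc : List ℕ)

/-- Along the Horner loop the accumulator is short with `W`-bit entries and the running power is
either the untouched input or short with `W`-bit entries. [folklore] -/
theorem foldl_lmulStep_bound (u : List ℕ) :
    ∀ (l : List ℕ) (acc w : List ℕ), acc.length ≤ pc.length → (∀ x ∈ acc, x < 2 ^ c.1) →
      (w = u ∨ (w.length ≤ pc.length ∧ ∀ x ∈ w, x < 2 ^ c.1)) →
      (l.foldl (fun st a => lmulStep c pc st a) (acc, w)).1.length ≤ pc.length ∧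
        (∀ x ∈ (l.foldl (fun st a => lmulStep c pc st a) (acc, w)).1, x < 2 ^ c.1) ∧
        ((l.foldl (fun st a => lmulStep c pc st a) (acc, w)).2 = u ∨
          ((l.foldl (fun st a => lmulStep c pc st a) (acc, w)).2.length ≤ pc.length ∧
            ∀ x ∈ (l.foldl (fun st a => lmulStep c pc st a) (acc, w)).2, x < 2 ^ c.1))
  | [], _, _, h1, h2, h3 => ⟨h1, h2, h3⟩
  | a :: l, acc, w, h1, h2, _ => by
    rw [List.foldl_cons]
    refine foldl_lmulStep_bound u l _ _ ?_ ?_ (Or.inr ⟨?_, ?_⟩)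
    · simp only [ladd, List.length_zipWith]; exact (min_le_left _ _).trans h1
    · intro x hx
      simp only [ladd] at hx
      obtain ⟨_, -, _, -, rfl⟩ := exists_of_mem_zipWith hx
      exact xorW_lt _ _ _
    · simp only [lmulz, List.length_zipWith, lsmul, List.length_map, List.length_cons]; exact min_le_right _ _
    · intro x hx
      simp only [lmulz] at hx
      obtain ⟨_, -, _, -, rfl⟩ := exists_of_mem_zipWith hx
      exact xorW_lt _ _ _

/-- `lmul` returns a short list of `W`-bit entries, on every input. [folklore] -/
theorem lmul_bound (u v : List ℕ) : (lmul c pc u v).length ≤ pc.length ∧ ∀ x ∈ lmul c pc u v, x < 2 ^ c.1 := by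
  obtain ⟨h1, h2, -⟩ := foldl_lmulStep_bound c pc u v (List.replicate pc.length 0) u (by rw [List.length_replicate])
    (fun x hx => by rw [List.eq_of_mem_replicate hx]; exact Nat.two_pow_pos _) (Or.inl rfl)
  exact ⟨h1, h2⟩

/-- `lone d` has length `d` and entries `≤ 1`. [folklore] -/
theorem lone_bound (d : ℕ) : (lone d).length = d ∧ ∀ x ∈ lone d, x ≤ 1 := by
  refine ⟨by rw [lone, List.length_map, List.length_range], fun x hx => ?_⟩
  rw [lone, List.mem_map] at hx
  obtain ⟨j, -, rfl⟩ := hx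
  split_ifs <;> simp

/-- Along the `lpowU` loop the accumulator is short with `(W+1)`-bit entries. [folklore] -/
theorem foldl_lpowU_bound (u : List ℕ) : ∀ (l : List Unit) (acc : List ℕ), acc.length ≤ pc.length →
    (∀ x ∈ acc, x < 2 ^ (c.1 + 1)) →
    (l.foldl (fun acc _ => lmul c pc acc u) acc).length ≤ pc.length ∧
      ∀ x ∈ l.foldl (fun acc _ => lmul c pc acc u) acc, x < 2 ^ (c.1 + 1)
  | [], _, h1, h2 => ⟨h1, h2⟩
  | _ :: l, acc, _, _ => by
    rw [List.foldl_cons]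
    obtain ⟨h1, h2⟩ := lmul_bound c pc acc u
    exact foldl_lpowU_bound u l _ h1 fun x hx => (h2 x hx).trans_le (Nat.pow_le_pow_right two_pos (Nat.le_succ _))

/-- Along the `lsqIter` loop the state is the input or short with `W`-bit entries. [folklore] -/
theorem foldl_lsqIter_bound (u : List ℕ) : ∀ (l : List Unit) (w : List ℕ),
    (w = u ∨ (w.length ≤ pc.length ∧ ∀ x ∈ w, x < 2 ^ c.1)) →
    (l.foldl (fun w _ => lmul c pc w w) w = u ∨
      ((l.foldl (fun w _ => lmul c pc w w) w).length ≤ pc.length ∧ ∀ x ∈ l.foldl (fun w _ => lmul c pc w w) w, x < 2 ^ c.1))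
  | [], _, h => h
  | _ :: l, w, _ => by
    rw [List.foldl_cons]
    exact foldl_lsqIter_bound u l _ (Or.inr (lmul_bound c pc w w))

/-- Along the `lpowB` loop: accumulator short with `(W+1)`-bit entries, running square the input or
short with `W`-bit entries, remaining exponent at most the exponent. [folklore] -/
theorem foldl_lpowBStep_bound (u : List ℕ) (z : ℕ) : ∀ (l : List Unit) (st : List ℕ × List ℕ × ℕ),
    st.1.length ≤ pc.length → (∀ x ∈ st.1, x < 2 ^ (c.1 + 1)) →
    (st.2.1 = u ∨ (st.2.1.length ≤ pc.length ∧ ∀ x ∈ st.2.1, x < 2 ^ c.1)) → st.2.2 ≤ z →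
    (l.foldl (fun st _ => lpowBStep c pc st) st).1.length ≤ pc.length ∧
      (∀ x ∈ (l.foldl (fun st _ => lpowBStep c pc st) st).1, x < 2 ^ (c.1 + 1)) ∧
      ((l.foldl (fun st _ => lpowBStep c pc st) st).2.1 = u ∨
        ((l.foldl (fun st _ => lpowBStep c pc st) st).2.1.length ≤ pc.length ∧
          ∀ x ∈ (l.foldl (fun st _ => lpowBStep c pc st) st).2.1, x < 2 ^ c.1)) ∧
      (l.foldl (fun st _ => lpowBStep c pc st) st).2.2 ≤ z
  | [], _, h1, h2, h3, h4 => ⟨h1, h2, h3, h4⟩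
  | _ :: l, st, h1, h2, _, h4 => by
    rw [List.foldl_cons]
    refine foldl_lpowBStep_bound u z l _ ?_ ?_ (Or.inr (lmul_bound c pc _ _)) ((Nat.div_le_self _ _).trans h4)
    · simp only [lpowBStep]
      split_ifs
      · exact (lmul_bound c pc _ _).1
      · exact h1
    · simp only [lpowBStep]
      split_ifs
      · exact fun x hx => ((lmul_bound c pc _ _).2 x hx).trans_le (Nat.pow_le_pow_right two_pos (Nat.le_succ _))
      · exact h2

/-- Raw codes of lists of `W`-bit numbers are short. [folklore] -/
theorem length_rawE_natE_le_of_lt {l : List ℕ} {W : ℕ} (h : ∀ x ∈ l, x < 2 ^ W) :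
    (rawE natE l).length ≤ l.length * (2 * W + 2) := by
  induction l with
  | nil => simp
  | cons a l ih =>
    rw [rawE_cons, length_boolPair, List.length_cons, add_mul, one_mul, length_natE]
    have ha : Nat.size a ≤ W := Nat.size_le.2 (h a List.mem_cons_self)
    have hl := ih fun x hx => h x (List.mem_cons_of_mem a hx)
    omega

/-- The arithmetic of the loop bounds. [folklore] -/
theorem loop_bound_arith {R W U N k : ℕ} (hR : R ≤ N) (hW : 2 * W + 4 ≤ N) (hU : U ≤ N) :
    k * (R * (2 * W + 4)) + U + 2 ≤ k * N * N + N + 2 := by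
  have : R * (2 * W + 4) ≤ N * N := Nat.mul_le_mul hR hW
  have : k * (R * (2 * W + 4)) ≤ k * (N * N) := Nat.mul_le_mul_left k this
  rw [Nat.mul_assoc]; omega

end Bounds

/-! ### `CodeFP` certificates -/

section Machine

/-- Code of `(c, pc, u)`: context, modulus coefficients, one operand. [folklore] -/
abbrev l3E : (ℕ × ℕ × ℕ) × List ℕ × List ℕ → List Bool := pairE kctxE (pairE (rawE natE) (rawE natE))

/-- **`ladd` on codes**: `(1ᵂ, u, v) ↦ ladd W u v`. [cite: AroraBarak2009, §1.3] -/
theorem laddFP : CodeFP (pairE unE (pairE (rawE natE) (rawE natE))) (rawE natE) (fun p => ladd p.1 p.2.1 p.2.2) :=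
  (zipWith xorFP).congr fun _ => rfl

/-- **`lsmul` on codes**: `(c, a, u) ↦ lsmul c a u`. [cite: AroraBarak2009, §1.3] -/
theorem lsmulFP : CodeFP (pairE kctxE (pairE natE (rawE natE))) (rawE natE) (fun p => lsmul p.1 p.2.1 p.2.2) := by
  have hg : CodeFP (pairE (pairE kctxE natE) natE) natE
      (fun t => GF2X.mulMod t.1.1.1 t.1.1.2.1 t.1.1.2.2 t.1.1.1 t.1.2 t.2) :=
    (kmulFP.comp ((fst _ _).fst'.pair ((fst _ _).snd'.pair (snd _ _))) :)
  exact ((map hg).comp (((fst _ _).pair (snd _ _).fst').pair (snd _ _).snd')).congr fun _ => rfl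

/-- **`lmulz` on codes**: `(c, pc, u) ↦ lmulz c pc u`. [cite: AroraBarak2009, §1.3] -/
theorem lmulzFP : CodeFP l3E (rawE natE) (fun p => lmulz p.1 p.2.1 p.2.2) := by
  have hc : CodeFP l3E kctxE (fun p => p.1) := fst _ _
  have hpc : CodeFP l3E (rawE natE) (fun p => p.2.1) := (snd _ _).fst'
  have hu : CodeFP l3E (rawE natE) (fun p => p.2.2) := (snd _ _).snd'
  have hlead : CodeFP l3E natE (fun p => p.2.2.getD (p.2.1.length - 1) 0) :=
    (rawGetD natE natE_zero).comp (hu.pair (natSub.comp (((natLength natE).comp hpc).pair (const _ 1))))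
  have hsm : CodeFP l3E (rawE natE) (fun p => lsmul p.1 (p.2.2.getD (p.2.1.length - 1) 0) p.2.1) :=
    (lsmulFP.comp (hc.pair (hlead.pair hpc)) :)
  have hz : CodeFP l3E (rawE natE) (fun p => (0 :: p.2.2 : List ℕ)) := ((rawCons natE).comp ((const _ 0).pair hu) :)
  exact ((zipWith xorFP).comp (hc.fst'.pair (hz.pair hsm))).congr fun _ => rfl

/-- The code of `(c, pc, u)` dominates `W`, the raw code of `pc` and the raw code of `u`. [folklore] -/
theorem le_length_l3E (c : ℕ × ℕ × ℕ) (pc u : List ℕ) :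
    2 * c.1 + 4 ≤ (l3E (c, pc, u)).length ∧ (rawE natE pc).length ≤ (l3E (c, pc, u)).length ∧
      (rawE natE u).length ≤ (l3E (c, pc, u)).length := by
  obtain ⟨W, f, P⟩ := c
  simp only [pairE_apply, length_boolPair, length_unE]
  omega

/-- **`lmul` on codes**: `(c, pc, u, v) ↦ lmul c pc u v` (a fold over `v` whose accumulator stays
short: `foldl_lmulStep_bound`). [cite: AroraBarak2009, §1.3; KnuthTAOCP2, §4.6.1] -/
theorem lmulFP : CodeFP (pairE kctxE (pairE (rawE natE) (pairE (rawE natE) (rawE natE)))) (rawE natE)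
    (fun p => lmul p.1 p.2.1 p.2.2.1 p.2.2.2) := by
  let stE : List ℕ × List ℕ → List Bool := pairE (rawE natE) (rawE natE)
  have hstep : CodeFP (pairE l3E (pairE natE stE)) stE (fun t => lmulStep t.1.1 t.1.2.1 t.2.2 t.2.1) := by
    have hc : CodeFP (pairE l3E (pairE natE stE)) kctxE (fun t => t.1.1) := (fst _ _).fst'
    have hpc : CodeFP (pairE l3E (pairE natE stE)) (rawE natE) (fun t => t.1.2.1) := (fst _ _).snd'.fst'
    have ha : CodeFP (pairE l3E (pairE natE stE)) natE (fun t => t.2.1) := (snd _ _).fst'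
    have hacc : CodeFP (pairE l3E (pairE natE stE)) (rawE natE) (fun t => t.2.2.1) := (snd _ _).snd'.fst'
    have hw : CodeFP (pairE l3E (pairE natE stE)) (rawE natE) (fun t => t.2.2.2) := (snd _ _).snd'.snd'
    exact ((laddFP.comp (hc.fst'.pair (hacc.pair (lsmulFP.comp (hc.pair (ha.pair hw)))))).pair
      (lmulzFP.comp (hc.pair (hpc.pair hw))) :)
  have hinit : CodeFP l3E stE (fun s => (List.replicate s.2.1.length 0, s.2.2)) :=
    (((replicateOf natE).comp ((const _ 0).pair ((ulength natE).comp (snd _ _).fst'))).pair (snd _ _).snd' :)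
  have h := foldl (eσ := l3E) (eα := natE) (eβ := stE)
    (step := fun (s : (ℕ × ℕ × ℕ) × List ℕ × List ℕ) (a : ℕ) (st : List ℕ × List ℕ) => lmulStep s.1 s.2.1 st a)
    (init := fun s => (List.replicate s.2.1.length 0, s.2.2)) hstep hinit (3 * X * X + X + 2)
    (fun s l₁ l₂ => by
      obtain ⟨c, pc, u⟩ := s
      obtain ⟨h1, h2, h3⟩ := foldl_lmulStep_bound c pc u l₁ (List.replicate pc.length 0) u
        (by rw [List.length_replicate]) (fun x hx => by rw [List.eq_of_mem_replicate hx]; exact Nat.two_pow_pos _) (Or.inl rfl)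
      obtain ⟨hW, hR, hU⟩ := le_length_l3E c pc u
      have hN : (l3E (c, pc, u)).length ≤ (pairE l3E (rawE natE) ((c, pc, u), l₁ ++ l₂)).length := by
        show _ ≤ (boolPair (l3E (c, pc, u)) (rawE natE (l₁ ++ l₂))).length
        rw [length_boolPair]; omega
      dsimp only
      set N := (pairE l3E (rawE natE) ((c, pc, u), l₁ ++ l₂)).length
      set st := l₁.foldl (fun st a => lmulStep c pc st a) (List.replicate pc.length 0, u)
      have hA : (rawE natE st.1).length ≤ (rawE natE pc).length * (2 * c.1 + 4) :=
        (length_rawE_natE_le_of_lt h2).trans (Nat.mul_le_mul (h1.trans (length_le_length_rawE _ _)) (by omega))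
      have hB : (rawE natE st.2).length ≤ (rawE natE u).length + (rawE natE pc).length * (2 * c.1 + 4) := by
        rcases h3 with h3 | ⟨h3a, h3b⟩
        · rw [h3]; exact Nat.le_add_right _ _
        · exact ((length_rawE_natE_le_of_lt h3b).trans (Nat.mul_le_mul (h3a.trans (length_le_length_rawE _ _))
            (by omega))).trans (Nat.le_add_left _ _)
      have key := loop_bound_arith (k := 3) (hR.trans hN) (hW.trans hN) (hU.trans hN)
      simp only [eval_add, eval_mul, eval_X, eval_ofNat]
      change (pairE (rawE natE) (rawE natE) st).length ≤ _
      rw [pairE_apply, length_boolPair]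
      omega)
  exact (h.fst'.comp (((fst _ _).pair ((snd _ _).fst'.pair (snd _ _).snd'.fst')).pair (snd _ _).snd'.snd')).congr
    fun _ => rfl

/-- **`lone` on codes**: `1ᵈ ↦ lone d`. [folklore] -/
theorem loneFP : CodeFP unE (rawE natE) lone := by
  have hg : CodeFP natE natE (fun j => if j = 0 then 1 else 0) :=
    ((natEq.comp ((CodeFP.id natE).pair (const natE 0))).ite (const natE 1) (const natE 0)).congr fun j => by
      simp
  exact ((map₀ hg).comp urange).congr fun _ => rfl

/-- Code of `(c, pc, u, e)` with a unary last field. [folklore] -/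
abbrev l4uE : (ℕ × ℕ × ℕ) × List ℕ × List ℕ × ℕ → List Bool :=
  pairE kctxE (pairE (rawE natE) (pairE (rawE natE) unE))

/-- **`lpowU` on codes**: `(c, pc, u, 1ᵉ) ↦ lpowU c pc u e`. [cite: AroraBarak2009, §1.3; KnuthTAOCP2, §4.6.3] -/
theorem lpowUFP : CodeFP l4uE (rawE natE) (fun p => lpowU p.1 p.2.1 p.2.2.1 p.2.2.2) := by
  have hstep : CodeFP (pairE l3E (pairE unitE (rawE natE))) (rawE natE) (fun t => lmul t.1.1 t.1.2.1 t.2.2 t.1.2.2) :=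
    (lmulFP.comp ((fst _ _).fst'.pair ((fst _ _).snd'.fst'.pair ((snd _ _).snd'.pair (fst _ _).snd'.snd'))) :)
  have hinit : CodeFP l3E (rawE natE) (fun s => lone s.2.1.length) := loneFP.comp ((ulength natE).comp (snd _ _).fst')
  have h := foldl (eσ := l3E) (eα := unitE) (eβ := rawE natE)
    (step := fun (s : (ℕ × ℕ × ℕ) × List ℕ × List ℕ) (_ : Unit) (acc : List ℕ) => lmul s.1 s.2.1 acc s.2.2)
    (init := fun s => lone s.2.1.length) hstep hinit (X * X)
    (fun s l₁ l₂ => by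
      obtain ⟨c, pc, u⟩ := s
      obtain ⟨hl1, hl2⟩ := lone_bound pc.length
      obtain ⟨h1, h2⟩ := foldl_lpowU_bound c pc u l₁ (lone pc.length) hl1.le
        (fun x hx => (hl2 x hx).trans_lt (Nat.one_lt_two_pow (by omega)))
      obtain ⟨hW, hR, -⟩ := le_length_l3E c pc u
      have hN : (l3E (c, pc, u)).length ≤ (pairE l3E (rawE unitE) ((c, pc, u), l₁ ++ l₂)).length := by
        show _ ≤ (boolPair (l3E (c, pc, u)) (rawE unitE (l₁ ++ l₂))).length
        rw [length_boolPair]; omega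
      dsimp only
      set N := (pairE l3E (rawE unitE) ((c, pc, u), l₁ ++ l₂)).length
      have hA : (rawE natE (l₁.foldl (fun acc _ => lmul c pc acc u) (lone pc.length))).length ≤
          (rawE natE pc).length * (2 * c.1 + 4) :=
        (length_rawE_natE_le_of_lt h2).trans (Nat.mul_le_mul (h1.trans (length_le_length_rawE natE pc))
          (show 2 * (c.1 + 1) + 2 ≤ 2 * c.1 + 4 by omega))
      have key : (rawE natE pc).length * (2 * c.1 + 4) ≤ N * N := Nat.mul_le_mul (hR.trans hN) (hW.trans hN)
      simp only [eval_mul, eval_X]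
      exact hA.trans key)
  exact (h.comp (((fst _ _).pair ((snd _ _).fst'.pair (snd _ _).snd'.fst')).pair
    (replicateUnit.comp (snd _ _).snd'.snd'))).congr fun _ => rfl

/-- **`lsqIter` on codes**: `(c, pc, u, 1ᵏ) ↦ lsqIter c pc u k`. [cite: AroraBarak2009, §1.3; KnuthTAOCP2, §4.6.3] -/
theorem lsqIterFP : CodeFP l4uE (rawE natE) (fun p => lsqIter p.1 p.2.1 p.2.2.1 p.2.2.2) := by
  have hstep : CodeFP (pairE l3E (pairE unitE (rawE natE))) (rawE natE) (fun t => lmul t.1.1 t.1.2.1 t.2.2 t.2.2) :=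
    (lmulFP.comp ((fst _ _).fst'.pair ((fst _ _).snd'.fst'.pair ((snd _ _).snd'.pair (snd _ _).snd'))) :)
  have h := foldl (eσ := l3E) (eα := unitE) (eβ := rawE natE)
    (step := fun (s : (ℕ × ℕ × ℕ) × List ℕ × List ℕ) (_ : Unit) (w : List ℕ) => lmul s.1 s.2.1 w w)
    (init := fun s => s.2.2) hstep (snd _ _).snd' (X * X + X)
    (fun s l₁ l₂ => by
      obtain ⟨c, pc, u⟩ := s
      have h3 := foldl_lsqIter_bound c pc u l₁ u (Or.inl rfl)
      obtain ⟨hW, hR, hU⟩ := le_length_l3E c pc u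
      have hN : (l3E (c, pc, u)).length ≤ (pairE l3E (rawE unitE) ((c, pc, u), l₁ ++ l₂)).length := by
        show _ ≤ (boolPair (l3E (c, pc, u)) (rawE unitE (l₁ ++ l₂))).length
        rw [length_boolPair]; omega
      dsimp only
      set N := (pairE l3E (rawE unitE) ((c, pc, u), l₁ ++ l₂)).length
      have key : (rawE natE pc).length * (2 * c.1 + 4) ≤ N * N := Nat.mul_le_mul (hR.trans hN) (hW.trans hN)
      simp only [eval_mul, eval_X, eval_add]
      rcases h3 with h3 | ⟨h3a, h3b⟩
      · rw [h3]; exact (hU.trans hN).trans (by nlinarith)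
      · exact ((length_rawE_natE_le_of_lt h3b).trans (Nat.mul_le_mul (h3a.trans (length_le_length_rawE _ _))
          (show 2 * c.1 + 2 ≤ 2 * c.1 + 4 by omega))).trans (key.trans (Nat.le_add_right _ _)))
  exact (h.comp (((fst _ _).pair ((snd _ _).fst'.pair (snd _ _).snd'.fst')).pair
    (replicateUnit.comp (snd _ _).snd'.snd'))).congr fun _ => rfl

/-- Code of `(c, pc, u, z, B)`: binary exponent and unary round budget. [folklore] -/
abbrev l5E : (ℕ × ℕ × ℕ) × List ℕ × List ℕ × ℕ × ℕ → List Bool :=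
  pairE kctxE (pairE (rawE natE) (pairE (rawE natE) (pairE natE unE)))

/-- **`lpowB` on codes**: `(c, pc, u, z, 1ᴮ) ↦ lpowB c pc u z B`.
[cite: AroraBarak2009, §1.3; KnuthTAOCP2, §4.6.3] -/
theorem lpowBFP : CodeFP l5E (rawE natE) (fun p => lpowB p.1 p.2.1 p.2.2.1 p.2.2.2.1 p.2.2.2.2) := by
  -- context `σ = ((c, pc, u), z)`, state `(acc, p, z')`
  let σE : ((ℕ × ℕ × ℕ) × List ℕ × List ℕ) × ℕ → List Bool := pairE l3E natE
  let stE : List ℕ × List ℕ × ℕ → List Bool := pairE (rawE natE) (pairE (rawE natE) natE)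
  have hstep : CodeFP (pairE σE (pairE unitE stE)) stE (fun t => lpowBStep t.1.1.1 t.1.1.2.1 t.2.2) := by
    have hc : CodeFP (pairE σE (pairE unitE stE)) kctxE (fun t => t.1.1.1) := (fst _ _).fst'.fst'
    have hpc : CodeFP (pairE σE (pairE unitE stE)) (rawE natE) (fun t => t.1.1.2.1) := (fst _ _).fst'.snd'.fst'
    have hacc : CodeFP (pairE σE (pairE unitE stE)) (rawE natE) (fun t => t.2.2.1) := (snd _ _).snd'.fst'
    have hp : CodeFP (pairE σE (pairE unitE stE)) (rawE natE) (fun t => t.2.2.2.1) := (snd _ _).snd'.snd'.fst'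
    have hz : CodeFP (pairE σE (pairE unitE stE)) natE (fun t => t.2.2.2.2) := (snd _ _).snd'.snd'.snd'
    have hodd : CodeFP (pairE σE (pairE unitE stE)) bitE (fun t => decide (t.2.2.2.2 % 2 = 1)) :=
      natEq.comp ((natMod.comp (hz.pair (const _ 2))).pair (const _ 1))
    have h1 : CodeFP (pairE σE (pairE unitE stE)) (rawE natE)
        (fun t => if t.2.2.2.2 % 2 = 1 then lmul t.1.1.1 t.1.1.2.1 t.2.2.1 t.2.2.2.1 else t.2.2.1) :=
      (hodd.ite (lmulFP.comp (hc.pair (hpc.pair (hacc.pair hp)))) hacc).congr fun t => by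
        simp only [decide_eq_true_eq]
    exact (h1.pair ((lmulFP.comp (hc.pair (hpc.pair (hp.pair hp)))).pair (natDiv.comp (hz.pair (const _ 2))))).congr
      fun t => rfl
  have hinit : CodeFP σE stE (fun s => (lone s.1.2.1.length, s.1.2.2, s.2)) :=
    ((loneFP.comp ((ulength natE).comp (fst _ _).snd'.fst')).pair ((fst _ _).snd'.snd'.pair (snd _ _)) :)
  have h := foldl (eσ := σE) (eα := unitE) (eβ := stE)
    (step := fun (s : ((ℕ × ℕ × ℕ) × List ℕ × List ℕ) × ℕ) (_ : Unit) (st : List ℕ × List ℕ × ℕ) =>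
      lpowBStep s.1.1 s.1.2.1 st)
    (init := fun s => (lone s.1.2.1.length, s.1.2.2, s.2)) hstep hinit (4 * X * X + X + 4)
    (fun s l₁ l₂ => by
      obtain ⟨⟨c, pc, u⟩, z⟩ := s
      obtain ⟨hl1, hl2⟩ := lone_bound pc.length
      obtain ⟨h1, h2, h3, h4⟩ := foldl_lpowBStep_bound c pc u z l₁ (lone pc.length, u, z) hl1.le
        (fun x hx => (hl2 x hx).trans_lt (Nat.one_lt_two_pow (by omega))) (Or.inl rfl) le_rfl
      obtain ⟨hW, hR, hU⟩ := le_length_l3E c pc u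
      have hN : 4 * (l3E (c, pc, u)).length + 2 * (natE z).length ≤
          (pairE σE (rawE unitE) (((c, pc, u), z), l₁ ++ l₂)).length := by
        show _ ≤ (boolPair (boolPair (l3E (c, pc, u)) (natE z)) (rawE unitE (l₁ ++ l₂))).length
        rw [length_boolPair, length_boolPair]; omega
      dsimp only
      set N := (pairE σE (rawE unitE) (((c, pc, u), z), l₁ ++ l₂)).length
      set st := l₁.foldl (fun st _ => lpowBStep c pc st) (lone pc.length, u, z)
      have hA : (rawE natE st.1).length ≤ (rawE natE pc).length * (2 * c.1 + 4) :=
        (length_rawE_natE_le_of_lt h2).trans (Nat.mul_le_mul (h1.trans (length_le_length_rawE _ _)) (by omega))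
      have hB : (rawE natE st.2.1).length ≤ (rawE natE u).length + (rawE natE pc).length * (2 * c.1 + 4) := by
        rcases h3 with h3 | ⟨h3a, h3b⟩
        · rw [h3]; exact Nat.le_add_right _ _
        · exact ((length_rawE_natE_le_of_lt h3b).trans (Nat.mul_le_mul (h3a.trans (length_le_length_rawE _ _))
            (by omega))).trans (Nat.le_add_left _ _)
      have hC : (natE st.2.2).length ≤ (natE z).length := by
        rw [length_natE, length_natE]; exact Nat.size_le_size h4
      have key := loop_bound_arith (k := 4) (hR.trans (by omega)) (hW.trans (by omega))
        (show 2 * (rawE natE u).length + (natE z).length ≤ N by omega)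
      simp only [eval_add, eval_mul, eval_X, eval_ofNat]
      change (pairE (rawE natE) (pairE (rawE natE) natE) st).length ≤ _
      rw [pairE_apply, pairE_apply, length_boolPair, length_boolPair]
      omega)
  exact (h.fst'.comp ((((fst _ _).pair ((snd _ _).fst'.pair (snd _ _).snd'.fst')).pair (snd _ _).snd'.snd'.fst').pair
    (replicateUnit.comp (snd _ _).snd'.snd'.snd'))).congr fun _ => rfl

end Machine

end UmansFP

end Literature.Computability.Complexity

end
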